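import Mathlib.CategoryTheory.Groupoid
import Mathlib.CategoryTheory.Functor.FullyFaithful
import Mathlib.CategoryTheory.Products.Basic
import Literature.IUT.HodgeTheaters.ThetaHodgeTheaters
import HarnessLib

/-!
# [IUTchI] Corollary 3.7 (ii), (iii): the "[full]" claims — PROOFS

S. Mochizuki, *Inter-universal Teichmüller theory I*, §3, Corollary 3.7 (ii), (iii) (pp. 88–89)
and Corollary 3.9 (i), (ii) (p. 92) (kurims final manuscript May 2020)
[claim: Mochizuki2012, status: disputed]. PROOF-ONLY companion of
`Literature/IUT/HodgeTheaters/ThetaHodgeTheaters.lean` (statement module, abc-iut-L5-t2); no new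
definitions. (The Cor. 3.9 consequences are in `FrobeniusEtalePicturesProofs.lean`.)

Cor. 3.7 (ii): "we obtain a composite [full] poly-isomorphism `†D⊢_v ⥲ †D^Θ_v ⥲ ‡D⊢_v` by
composing the tautological isomorphism … with the poly-isomorphism induced by the Θ-link
poly-isomorphism of (i)"; (iii) is the same for `O^×_{C⊢_v}`. The bracketed "[full]"
(`ThetaLinkBaseFull`, `ThetaLinkUnitsFull`) says that EVERY isomorphism of base (resp. unit) data
is induced by an isomorphism of collections of data `†F⊩_tht ⥲ ‡F⊩_mod`. Over the bare groupoid
interface `HodgeTheaterModel` this fails (witness: all kinds of data the one-object discrete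
groupoid except `Base v = B(ℤ/2)`; then the induced poly-isomorphism is `{𝟙}`), and it holds in
print because the base/unit data are "constructed category-theoretically from" the collections of
data (Ex. 3.2 (vi), 3.3 (iii), 3.5 (ii); Rmk 3.5.2), i.e. the passage is SURJECTIVE on
isomorphisms. We record exactly this as the hypothesis — Mathlib's `Functor.Full` for
`M.component v ⋙ M.base v` (resp. `⋙ M.units v`, resp. the joint `⋙ (M.base v).prod' (M.units v)`
for the pair of Cor. 3.9 (ii)) — prove the lifting computation once, and discharge:

* `thetaLinkBaseFull_of_full`, `thetaLinkUnitsFull_of_full` (Cor. 3.7 (ii), (iii) "[full]");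
* `thetaLinkPair_eq_full_of_full` (the pair, joint lifting).

The interface carries the first two lifting properties as LAWS (`HodgeTheaterModel.componentBase_full`,
`componentUnits_full`; abc-iut-L5-lead ruling 2026-08-25), whence the unconditional discharges
`thetaLinkBaseFull_holds`, `thetaLinkUnitsFull_holds`; the joint (pair) lifting is NOT a law, so
the pair statement remains conditional (`thetaLinkPair_eq_full_of_full`). Nothing here bears on
the disputed parts of the series.
-/

namespace Literature.IUT.HodgeTheaters

open CategoryTheory CategoryTheory.Prod

universe u v w uM

section Cor37

variable {F : Type u} {K : Type v} {Fbar : Type w} [Field F] [NumberField F] [Field K]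
  [NumberField K] [Algebra F K] [Field Fbar] [Algebra F Fbar] [Algebra K Fbar]
  {E : WeierstrassCurve F} [E.IsElliptic] {l : ℕ} {P : BadPlacePredicates K}
  {D : InitialThetaData F K Fbar E l P}
  {M : HodgeTheaterModel D} (HT HT' : ThetaHodgeTheater M)

namespace ThetaHodgeTheater

/-- The lifting computation for the base data: if a morphism `g : †F⊩_tht ⟶ ‡F⊩_mod` of collections
of data induces, on `v̲`-components of base data, the conjugate of `h : †D⊢_v ≅ ‡D⊢_v`, then `h` is
the composite of Cor. 3.7 (ii) for the member `g` of the Θ-link.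
[claim: Mochizuki2012, status: disputed] -/
theorem eq_linkBase_of_map_eq (v : D.V) (h : HT.Ddash v ≅ HT'.Ddash v) (g : HT.Ftht ⟶ HT'.glob)
    (hg : (M.base v).map ((M.component v).map g) =
      (M.base v).map (HT.componentFtht v).hom ≫ (HT.tautBase v).inv ≫ h.hom ≫
        (M.base v).map (HT'.component_iso v).inv) :
    h = HT.tautBase v ≪≫ (M.base v).mapIso (HT.linkComponent HT' v (asIso g)) := by
  unfold linkComponent
  unfold ThetaHodgeTheater.tautBase ThetaHodgeTheater.componentFtht at hg ⊢
  unfold ThetaHodgeTheater.Ddash ThetaHodgeTheater.Fdash at h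
  unfold ThetaHodgeTheater.Ftht at g
  unfold ThetaHodgeTheater.Ddash ThetaHodgeTheater.Dtheta ThetaHodgeTheater.Fdash
    ThetaHodgeTheater.Ftheta ThetaHodgeTheater.Ftht at hg ⊢
  have hK : (M.base v).mapIso ((M.component v).mapIso (asIso g)) =
      (M.base v).mapIso ((M.component v).mapIso (M.tautGlob.app HT.glob).symm ≪≫
          HT.component_iso v ≪≫ (M.tautLoc v).app (HT.loc v)) ≪≫
        ((M.base v).mapIso ((M.tautLoc v).app (HT.loc v))).symm ≪≫ h ≪≫
        ((M.base v).mapIso (HT'.component_iso v)).symm := by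
    ext
    simp only [Functor.mapIso_hom, asIso_hom, Iso.trans_hom, Iso.symm_hom, Functor.mapIso_inv]
    exact hg
  rw [Functor.mapIso_trans, Functor.mapIso_trans, hK, Functor.mapIso_symm]
  simp only [Iso.trans_assoc, Iso.symm_self_id_assoc, Iso.self_symm_id_assoc, Iso.symm_self_id,
    Iso.trans_refl]

/-- The lifting computation for the unit data (as `eq_linkBase_of_map_eq`).
[claim: Mochizuki2012, status: disputed] -/
theorem eq_linkUnits_of_map_eq (v : D.V) (h : HT.unitsDash v ≅ HT'.unitsDash v)
    (g : HT.Ftht ⟶ HT'.glob)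
    (hg : (M.units v).map ((M.component v).map g) =
      (M.units v).map (HT.componentFtht v).hom ≫ (HT.tautUnits v).inv ≫ h.hom ≫
        (M.units v).map (HT'.component_iso v).inv) :
    h = HT.tautUnits v ≪≫ (M.units v).mapIso (HT.linkComponent HT' v (asIso g)) := by
  unfold linkComponent
  unfold ThetaHodgeTheater.tautUnits ThetaHodgeTheater.componentFtht at hg ⊢
  unfold ThetaHodgeTheater.unitsDash ThetaHodgeTheater.Fdash at h
  unfold ThetaHodgeTheater.Ftht at g
  unfold ThetaHodgeTheater.unitsDash ThetaHodgeTheater.unitsTheta ThetaHodgeTheater.Fdash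
    ThetaHodgeTheater.Ftheta ThetaHodgeTheater.Ftht at hg ⊢
  have hK : (M.units v).mapIso ((M.component v).mapIso (asIso g)) =
      (M.units v).mapIso ((M.component v).mapIso (M.tautGlob.app HT.glob).symm ≪≫
          HT.component_iso v ≪≫ (M.tautLoc v).app (HT.loc v)) ≪≫
        ((M.units v).mapIso ((M.tautLoc v).app (HT.loc v))).symm ≪≫ h ≪≫
        ((M.units v).mapIso (HT'.component_iso v)).symm := by
    ext
    simp only [Functor.mapIso_hom, asIso_hom, Iso.trans_hom, Iso.symm_hom, Functor.mapIso_inv]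
    exact hg
  rw [Functor.mapIso_trans, Functor.mapIso_trans, hK, Functor.mapIso_symm]
  simp only [Iso.trans_assoc, Iso.symm_self_id_assoc, Iso.self_symm_id_assoc, Iso.symm_self_id,
    Iso.trans_refl]

/-- **Cor. 3.7 (ii), p. 88, "[full]"** for any model in which the base data lift
(`M.component v ⋙ M.base v` full). [claim: Mochizuki2012, status: disputed] -/
theorem thetaLinkBaseFull_of_full (v : D.V) [(M.component v ⋙ M.base v).Full] :
    ThetaLinkBaseFull HT HT' v := by
  unfold ThetaLinkBaseFull PolyIso.full thetaLinkBase
  refine Set.eq_univ_of_forall fun h => ?_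
  let g : HT.Ftht ⟶ HT'.glob := (M.component v ⋙ M.base v).preimage
    ((M.base v).map (HT.componentFtht v).hom ≫ (HT.tautBase v).inv ≫ h.hom ≫
      (M.base v).map (HT'.component_iso v).inv)
  exact ⟨asIso g, Set.mem_univ _,
    HT.eq_linkBase_of_map_eq HT' v h g ((M.component v ⋙ M.base v).map_preimage _)⟩

/-- **Cor. 3.7 (iii), p. 89, "[full]"** for any model in which the unit data lift
(`M.component v ⋙ M.units v` full). [claim: Mochizuki2012, status: disputed] -/
theorem thetaLinkUnitsFull_of_full (v : D.V) [(M.component v ⋙ M.units v).Full] :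
    ThetaLinkUnitsFull HT HT' v := by
  unfold ThetaLinkUnitsFull PolyIso.full thetaLinkUnits
  refine Set.eq_univ_of_forall fun h => ?_
  let g : HT.Ftht ⟶ HT'.glob := (M.component v ⋙ M.units v).preimage
    ((M.units v).map (HT.componentFtht v).hom ≫ (HT.tautUnits v).inv ≫ h.hom ≫
      (M.units v).map (HT'.component_iso v).inv)
  exact ⟨asIso g, Set.mem_univ _,
    HT.eq_linkUnits_of_map_eq HT' v h g ((M.component v ⋙ M.units v).map_preimage _)⟩

/-- **Cor. 3.7 (ii), p. 88, "[full]" — DISCHARGED** from the interface law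
`HodgeTheaterModel.componentBase_full` (the base data `D⊢_v̲` are "constructed
category-theoretically from" the collections of data, so every isomorphism lifts).
[claim: Mochizuki2012, status: disputed] -/
theorem thetaLinkBaseFull_holds (v : D.V) : ThetaLinkBaseFull HT HT' v := by
  haveI := M.componentBase_full v
  exact thetaLinkBaseFull_of_full HT HT' v

/-- **Cor. 3.7 (iii), p. 89, "[full]" — DISCHARGED** from the interface law
`HodgeTheaterModel.componentUnits_full`. [claim: Mochizuki2012, status: disputed] -/
theorem thetaLinkUnitsFull_holds (v : D.V) : ThetaLinkUnitsFull HT HT' v := by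
  haveI := M.componentUnits_full v
  exact thetaLinkUnitsFull_of_full HT HT' v

/-- **Cor. 3.7 (ii)+(iii), the pair "[full]"** under the JOINT lifting hypothesis: every
isomorphism of the pair `(D⊢_v, O^×_{C⊢_v})` between `v̲`-components lifts to an isomorphism of
collections of data. [claim: Mochizuki2012, status: disputed] -/
theorem thetaLinkPair_eq_full_of_full (v : D.V)
    [(M.component v ⋙ (M.base v).prod' (M.units v)).Full] :
    HT.thetaLinkPair HT' v = PolyIso.full _ _ := by
  unfold PolyIso.full thetaLinkPair
  refine Set.eq_univ_of_forall fun h => ?_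
  -- the two components of `h`
  let hb : HT.Ddash v ≅ HT'.Ddash v := (CategoryTheory.Prod.fst _ _).mapIso h
  let hu : HT.unitsDash v ≅ HT'.unitsDash v := (CategoryTheory.Prod.snd _ _).mapIso h
  let kb := (M.base v).map (HT.componentFtht v).hom ≫ (HT.tautBase v).inv ≫ hb.hom ≫
      (M.base v).map (HT'.component_iso v).inv
  let ku := (M.units v).map (HT.componentFtht v).hom ≫ (HT.tautUnits v).inv ≫ hu.hom ≫
      (M.units v).map (HT'.component_iso v).inv
  let g : HT.Ftht ⟶ HT'.glob := (M.component v ⋙ (M.base v).prod' (M.units v)).preimage (kb ×ₘ ku)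
  have hg : ((M.base v).prod' (M.units v)).map ((M.component v).map g) = kb ×ₘ ku :=
    (M.component v ⋙ (M.base v).prod' (M.units v)).map_preimage _
  have hgb : (M.base v).map ((M.component v).map g) = kb := congrArg Prod.fst hg
  have hgu : (M.units v).map ((M.component v).map g) = ku := congrArg Prod.snd hg
  refine ⟨asIso g, Set.mem_univ _, ?_⟩
  have eb := HT.eq_linkBase_of_map_eq HT' v hb g hgb
  have eu := HT.eq_linkUnits_of_map_eq HT' v hu g hgu
  rw [← eb, ← eu]
  ext <;> rfl

end ThetaHodgeTheater

end Cor37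

end Literature.IUT.HodgeTheaters
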